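import Summits.AtomisticToContinuum.BoseEinsteinCondensation.Theorems.BECInsertionCorrectorStaticResponseBoundTruncationCompactness
import HarnessLib

/-!
# Stub D2b `stub_truncatedEnergyLSC_of_maxFormBound` of line `coupling-monotone-chord` (crux
# `GaussianDominationCan`, item stmt-AtomisticToContinuum-9479): the truncation LSC reduced to the maximal-form bound

D2 is the lower semicontinuity of the periodic `C¹`-core ground-state energy under truncation of the
pair potential at fixed `(N, L)`, `E₀(v) ≤ ⨆_{h>0} E₀(min(v, h))` (hard cores allowed: `v` is any
measurable finite-range profile with values in `[0, ∞]`).  Classically this is monotone convergence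
of closed forms [Simon 1978] + compactness of the resolvent on the torus + the statement that the
Bose-symmetric periodic `C¹` functions realise the infimum of the MAXIMAL hard-core form
(`MaxFormBound`, no Lavrentiev gap).  The first two ingredients are in the tree
(`…StaticResponseBoundTruncationCompactness.exists_limitProfile`: Rellich + Fatou + Beppo Levi); the
third is the registered, unproved stub `stub_maxFormBound` of the sibling crux `StaticResponseBound`
(item stmt-AtomisticToContinuum-12057), verbatim the hypothesis `hcore` of
`…UvThomsonForceWave.truncationLimit_of_maxFormBound`.

Proved here (sorry-free, no new definitions):

* `periodicGroundStateEnergy_truncPotential_le_iSup_real` — the natural truncations `min(v, n)`,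
  `n : ℕ`, are a sub-family of the real ones: `E₀(min(v,n)) ≤ ⨆_{h>0} E₀(min(v, h))`
  (monotonicity `n ≤ n + 1` and `ENNReal.ofReal (n+1) = n+1`);
* `stub_truncatedEnergyLSC_of_maxFormBound` — **the registered stub D2b (lead reshape r2): the reduction** `MaxFormBound → D2` (verbatim the registered
  signature of `stub_truncatedEnergyLSC` as conclusion): if `⨆_{h>0} E₀(min(v,h)) = ⊤` there is nothing
  to show; otherwise the natural truncations have bounded energies, `exists_limitProfile` produces a unit
  Bose-symmetric `η ∈ L²((ℝ/ℤ)^{3N})` of maximal-form energy `≤ ⨆ₙ E₀(min(v,n))`, and `MaxFormBound`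
  bounds `E₀(v)` by that energy.  No finiteness hypothesis on `E₀(v)` is needed (the jammed case
  `E₀(v) = ⊤` forces `⨆ₕ E₀(min(v,h)) = ⊤` through the same chain).

References: B. Simon, *J. Funct. Anal.* 28 (1978) 377–385, Thms 3.1, 4.1; B. Simon, *J. Operator
Theory* 1 (1979) 37–47; [ReedSimonIV1978] Thm XIII.64; [LSSY2005] App. A.
-/

noncomputable section

namespace Summit.AtomisticToContinuum.BoseEinsteinCondensation.Cruxes.GaussianDominationCan.CouplingMonotoneChord

open MeasureTheory Filter UnitAddTorus
open scoped ENNReal NNReal BigOperators Topology InnerProductSpace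
open Literature.MathematicalPhysics.QuantumManyBody.BoseGas
open Summit.AtomisticToContinuum.BoseEinsteinCondensation.Cruxes.StaticResponseBound.UvThomsonForceWave

-- The measure on `ℝ/ℤ` is the Haar PROBABILITY measure, as in `PeriodicFormDomain.lean` and in
-- `…StaticResponseBoundTruncationCompactness.lean` (so that `MaxFormBound` below is syntactically the
-- hypothesis `hcore` of `truncationLimit_of_maxFormBound`).
attribute [local instance] Literature.MathematicalPhysics.QuantumManyBody.BoseGas.formDomain_measureSpace
  Literature.MathematicalPhysics.QuantumManyBody.BoseGas.formDomain_isProbabilityMeasure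
  Literature.MathematicalPhysics.QuantumManyBody.BoseGas.formDomain_isProbabilityMeasure_pi

/-- The natural truncations are a sub-family of the real ones:
`E₀(min(v, n)) ≤ ⨆_{h>0} E₀(min(v, h))` for every `n : ℕ` (via `n ≤ n + 1` and `h = n + 1 > 0`).
[folklore] -/
theorem periodicGroundStateEnergy_truncPotential_le_iSup_real (v : ℝ → ℝ≥0∞) (N : ℕ) (L : ℝ) (n : ℕ) :
    periodicGroundStateEnergy (truncPotential v n) N L ≤
      ⨆ (h : ℝ) (_ : 0 < h), periodicGroundStateEnergy (fun r => min (v r) (ENNReal.ofReal h)) N L := by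
  refine (monotone_periodicGroundStateEnergy_truncPotential v N L n.le_succ).trans ?_
  change periodicGroundStateEnergy (truncPotential v (n + 1)) N L ≤ _
  have hfun : truncPotential v (n + 1) = fun r => min (v r) (ENNReal.ofReal ((n + 1 : ℕ) : ℝ)) := by
    funext r
    rw [ENNReal.ofReal_natCast]
    rfl
  rw [hfun]
  exact le_iSup₂ (f := fun (h : ℝ) (_ : 0 < h) =>
    periodicGroundStateEnergy (fun r => min (v r) (ENNReal.ofReal h)) N L) ((n + 1 : ℕ) : ℝ)
    (by positivity)

/-- **Registered stub D2b — reduction of the truncation lower semicontinuity (former D2) to ONE missing fact (`MaxFormBound`, the hypothesis `hcore`, verbatim the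
hypothesis of `…UvThomsonForceWave.truncationLimit_of_maxFormBound` = the registered stub
`stub_maxFormBound` of item stmt-AtomisticToContinuum-12057).**  If for every admissible `v`, every `N`,
`L > 0` and every unit vector `η ∈ L²((ℝ/ℤ)^{3N})` that is Bose-symmetric in momentum space the
`C¹`-core ground-state energy is bounded by the maximal-form energy of `η`, then
`E₀(v) ≤ ⨆_{h>0} E₀(min(v,h))` at every `(m + 1, L)`, `L > 0`: either the supremum is `⊤`, or the
natural truncations have bounded energies, the limit profile `η` of `exists_limitProfile` (Rellich +
Fatou + Beppo Levi) has maximal-form energy `≤ ⨆ₙ E₀(min(v,n)) ≤ ⨆_{h>0} E₀(min(v,h))`, and `hcore`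
bounds `E₀(v)` by it. [folklore] -/
theorem stub_truncatedEnergyLSC_of_maxFormBound :
    (∀ v : ℝ → ℝ≥0∞, IsRepulsiveFiniteRange v → ∀ (N : ℕ) (L : ℝ), 0 < L →
      ∀ η : Lp ℂ 2 (volume : Measure (UnitAddTorus (Fin N × Fin 3))), ‖η‖ = 1 →
        (∀ (σ : Equiv.Perm (Fin N)) (n : Fin N × Fin 3 → ℤ),
          ⟪(mFourierLp 2 (fun p : Fin N × Fin 3 => n (σ p.1, p.2)) :
              Lp ℂ 2 (volume : Measure (UnitAddTorus (Fin N × Fin 3)))), η⟫_ℂ =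
            ⟪(mFourierLp 2 n : Lp ℂ 2 (volume : Measure (UnitAddTorus (Fin N × Fin 3)))), η⟫_ℂ) →
        periodicGroundStateEnergy v N L ≤
          ∑' n : Fin N × Fin 3 → ℤ, ENNReal.ofReal (∑ p, (2 * Real.pi * (n p : ℝ) / L) ^ 2) *
              (‖⟪(mFourierLp 2 n : Lp ℂ 2 (volume : Measure (UnitAddTorus (Fin N × Fin 3)))), η⟫_ℂ‖₊ :
                ℝ≥0∞) ^ 2 +
            ∫⁻ t, periodicInteraction v L (fromUnitTorusN L t) *
              (‖(η : UnitAddTorus (Fin N × Fin 3) → ℂ) t‖₊ : ℝ≥0∞) ^ 2) →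
    ∀ v : ℝ → ℝ≥0∞, IsRepulsiveFiniteRange v → ∀ m : ℕ, ∀ L : ℝ, 0 < L →
      periodicGroundStateEnergy v (m + 1) L ≤
        ⨆ (h : ℝ) (_ : 0 < h),
          periodicGroundStateEnergy (fun r => min (v r) (ENNReal.ofReal h)) (m + 1) L := by
  intro hcore v hv m L hL
  -- the natural truncations sit below the real supremum
  have hsup_nat : (⨆ n : ℕ, periodicGroundStateEnergy (truncPotential v n) (m + 1) L) ≤
      ⨆ (h : ℝ) (_ : 0 < h), periodicGroundStateEnergy (fun r => min (v r) (ENNReal.ofReal h)) (m + 1) L :=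
    iSup_le fun n => periodicGroundStateEnergy_truncPotential_le_iSup_real v (m + 1) L n
  by_cases hS : (⨆ (h : ℝ) (_ : 0 < h),
      periodicGroundStateEnergy (fun r => min (v r) (ENNReal.ofReal h)) (m + 1) L) = ⊤
  · -- the jammed / infinite case: nothing to show
    rw [hS]
    exact le_top
  · -- bounded truncated energies: compactness half + the maximal-form bound
    have hne : (⨆ n : ℕ, periodicGroundStateEnergy (truncPotential v n) (m + 1) L) ≠ ⊤ :=
      ne_top_of_le_ne_top hS hsup_nat
    obtain ⟨η, hη1, hηsymm, hηE⟩ := exists_limitProfile (N := m + 1) hv.1 hL hne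
    exact ((hcore v hv (m + 1) L hL η hη1 hηsymm).trans hηE).trans hsup_nat

end Summit.AtomisticToContinuum.BoseEinsteinCondensation.Cruxes.GaussianDominationCan.CouplingMonotoneChord

end
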